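import Literature.MathematicalPhysics.KineticTheory.CollisionWindowStationarity
import HarnessLib

/-!
# Windowed collision counts of a tagged hard sphere: pathwise count, Markov and stationarity

Topic `Literature/MathematicalPhysics/KineticTheory` — companion of `CollisionWindowCompensator.lean` (windows
`window N τ a k = [kw, (k+1)w)`, `Kw = windowNum`, `w = windowLen ≤ a (N+1)^{-1/3}`, the windowed collision count
`windowCollisions σ N Φ τ a i k` = `D_{i,k}` of sphere `i` in window `k` along the orbit of a hard-sphere flow `Φ`) and of
`CollisionFluxUpperBound.lean` (the window bound for collision sums under a flow-invariant law).  Theorems only: the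
dynamics-free / pathwise / measure-theoretic bookkeeping that reduces moment bounds and the TIGHTNESS of the squared
window sum `F = ε/(N+1) · Σ_i Σ_{k<Kw} D_{i,k}²` under a flow-invariant law to ONE-WINDOW quantities of ONE sphere
(Cercignani–Illner–Pulvirenti 1994, App. 4.A: collisions in short time windows; Gallagher–Saint-Raymond–Texier 2013,
§4.1: the flow is a one-parameter group of piecewise-free, binary-collision trajectories on the good set):

* `ncard_collisionTimesOf_inter_Icc_le_finsum` — PATHWISE, the number of collision times of sphere `i` in `[0, T]`
  along a good orbit is at most the collision sum (over collision times and ordered contact pairs `(p, q)`) of the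
  mark `𝟙[p = i ∨ q = i]` — the form consumed by the window bound `measure_collisionSum_ge_le_liminf` and its
  lower-integral twin, whose one-window means are static two-label events;
* `succ_mul_hsDiameter_sq_mul_nominalWindow` — the tagged-sphere window factor is `N`-free:
  `(N+1) ε_N² · a (N+1)^{-1/3} = σ² a` (so `N` partners × cross-section `ε²` × window = `O(σ² a)` collisions);
* `measure_lt_windowSqSum_le` — MARKOV + STATIONARITY: for a law `μ` not charging the bad set, preserved by the window
  shifts `Φ_{kw}`, with measurable window counts, `μ{Kb < F} ≤ Kb⁻¹ · ε/(N+1) · Kw · Σ_i ∫ D_{i,0}² dμ` (the shift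
  identity `D_{i,k} = D_{i,0} ∘ Φ_{kw}` on the good set is `windowCollisions_ae_eq_comp_flow` of
  `CollisionWindowStationarity.lean`);
* `hsDiameter_mul_windowNum_le` — the normalisation is `N`-free: `ε_N Kw ≤ σ (τ/a + 1)`.

So `F` is tight uniformly in `N` as soon as `(N+1)⁻¹ Σ_i ∫ D_{i,0}² dμ` is bounded uniformly in `N`.  The one-window
FIRST moment is static (`O(σ² a)`, problem-side from the window bound); the second factorial moment
`E[D_{i,0}(D_{i,0} − 1)]` (pairs of collisions of one sphere within one window) is a two-time correlation of the
dynamics and is NOT a one-window static event.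

## References

* C. Cercignani, R. Illner, M. Pulvirenti, *The Mathematical Theory of Dilute Gases* (1994), App. 4.A.
  [CIPDiluteGases1994]
* I. Gallagher, L. Saint-Raymond, B. Texier, *From Newton to Boltzmann* (2013), §4.1, Prop. 4.1.1.  [GST2013]
* H. Spohn, *Large Scale Dynamics of Interacting Particles* (1991), Part I §2.3.  [Spohn1991]
-/

noncomputable section

open MeasureTheory Set Filter Topology
open scoped ENNReal BigOperators Classical

namespace Literature.MathematicalPhysics.KineticTheory

open Literature.Analysis.FluidPDE

/-! ## Pathwise: the collision count of one sphere is a collision sum -/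

/-- **The number of collision times of sphere `i` in `[0, T]` along a good orbit is at most the collision sum of
the mark `𝟙[p = i ∨ q = i]`** over the ordered contact pairs `(p, q)`: at a collision time of `i` some ordered
contact pair contains `i` (`mem_collisionTimesOf`, `mem_contactPairs`), and the collision times of `i` are
collision times (`collisionTimesOf_subset`). [folklore] -/
theorem ncard_collisionTimesOf_inter_Icc_le_finsum {d X : Type*} [Fintype d] [MeasureSpace X]
    [TopologicalSpace X] {G : Geometry d X} {ε : ℝ} {n : ℕ} (Φ : HardSphereFlow G ε n) {z : Config n d X}
    (hz : z ∈ Φ.good) (i : Fin n) (T : ℝ) :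
    ((collisionTimesOf G ε (fun t => Φ.flow t z) i ∩ Icc 0 T).ncard : ℝ≥0∞) ≤
      ∑ᶠ s ∈ collisionTimes G ε (fun t => Φ.flow t z) ∩ Icc 0 T,
        ∑ p, ∑ q, (if p ≠ q ∧ ‖G.sepVec (Φ.flow s z p).1 (Φ.flow s z q).1‖ = ε
          then (if p = i ∨ q = i then (1 : ℝ≥0∞) else 0) else 0) := by
  have hγ := Φ.isTrajectory z hz
  have hfin := hγ.locFinite 0 T
  have hfin' := hfin.subset (inter_subset_inter_left (Icc 0 T) (collisionTimesOf_subset (fun t => Φ.flow t z) i))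
  -- the inner sum is at least `1` at a collision time of `i`
  have hone : ∀ s ∈ collisionTimesOf G ε (fun t => Φ.flow t z) i, (1 : ℝ≥0∞) ≤
      ∑ p, ∑ q, (if p ≠ q ∧ ‖G.sepVec (Φ.flow s z p).1 (Φ.flow s z q).1‖ = ε
        then (if p = i ∨ q = i then (1 : ℝ≥0∞) else 0) else 0) := by
    intro s hs
    obtain ⟨j, hj⟩ := mem_collisionTimesOf.1 hs
    -- the ordered contact pair containing `i`
    have key : ∀ p q : Fin n, (p, q) ∈ contactPairs G ε (Φ.flow s z) → p = i ∨ q = i → (1 : ℝ≥0∞) ≤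
        ∑ p, ∑ q, (if p ≠ q ∧ ‖G.sepVec (Φ.flow s z p).1 (Φ.flow s z q).1‖ = ε
          then (if p = i ∨ q = i then (1 : ℝ≥0∞) else 0) else 0) := by
      intro p q hpq hi
      obtain ⟨hne, hc⟩ := mem_contactPairs.1 hpq
      have hnorm : ‖G.sepVec (Φ.flow s z p).1 (Φ.flow s z q).1‖ = ε := (mem_contactSet.1 hc).2
      calc (1 : ℝ≥0∞) = (if p ≠ q ∧ ‖G.sepVec (Φ.flow s z p).1 (Φ.flow s z q).1‖ = ε
            then (if p = i ∨ q = i then (1 : ℝ≥0∞) else 0) else 0) := by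
            rw [if_pos ⟨hne, hnorm⟩, if_pos hi]
        _ ≤ ∑ q', (if p ≠ q' ∧ ‖G.sepVec (Φ.flow s z p).1 (Φ.flow s z q').1‖ = ε
            then (if p = i ∨ q' = i then (1 : ℝ≥0∞) else 0) else 0) :=
            Finset.single_le_sum (f := fun q' => (if p ≠ q' ∧ ‖G.sepVec (Φ.flow s z p).1 (Φ.flow s z q').1‖ = ε
              then (if p = i ∨ q' = i then (1 : ℝ≥0∞) else 0) else 0)) (fun _ _ => zero_le)
              (Finset.mem_univ q)
        _ ≤ _ := Finset.single_le_sum (f := fun p' => ∑ q', (if p' ≠ q' ∧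
              ‖G.sepVec (Φ.flow s z p').1 (Φ.flow s z q').1‖ = ε
              then (if p' = i ∨ q' = i then (1 : ℝ≥0∞) else 0) else 0)) (fun _ _ => zero_le)
              (Finset.mem_univ p)
    exact hj.elim (fun hj => key i j hj (Or.inl rfl)) fun hj => key j i hj (Or.inr rfl)
  rw [finsum_mem_eq_finite_toFinset_sum _ hfin, Set.ncard_eq_toFinset_card _ hfin']
  calc ((hfin'.toFinset.card : ℕ) : ℝ≥0∞) = ∑ _s ∈ hfin'.toFinset, (1 : ℝ≥0∞) := by
        rw [Finset.sum_const, nsmul_eq_mul, mul_one]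
    _ ≤ ∑ s ∈ hfin'.toFinset, ∑ p, ∑ q, (if p ≠ q ∧ ‖G.sepVec (Φ.flow s z p).1 (Φ.flow s z q).1‖ = ε
          then (if p = i ∨ q = i then (1 : ℝ≥0∞) else 0) else 0) :=
        Finset.sum_le_sum fun s hs => hone s ((Set.Finite.mem_toFinset hfin').1 hs).1
    _ ≤ _ := by
        refine Finset.sum_le_sum_of_subset fun s hs => ?_
        rw [Set.Finite.mem_toFinset] at hs ⊢
        exact ⟨collisionTimesOf_subset _ i hs.1, hs.2⟩

/-! ## The tagged-sphere window factor -/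

/-- At fixed reduced density the tagged-sphere window factor is `N`-free:
`(N+1) ε_N² · (aw (N+1)^{-1/3}) = σ² aw` (`(N+1) ε_N³ = σ³`, `ε_N = σ (N+1)^{-1/3}`, `σ > 0`). [folklore] -/
theorem succ_mul_hsDiameter_sq_mul_nominalWindow {σ : ℝ} (hσ : 0 < σ) (N : ℕ) (aw : ℝ) :
    ((N + 1 : ℕ) : ℝ) * hsDiameter σ N ^ 2 * (aw * ((N + 1 : ℕ) : ℝ) ^ (-(1 / 3 : ℝ))) = σ ^ 2 * aw := by
  have h3 := succ_mul_hsDiameter_pow_three σ N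
  unfold hsDiameter at h3 ⊢
  set m : ℝ := ((N + 1 : ℕ) : ℝ) ^ (-(1 / 3 : ℝ)) with hm
  have hre : ((N + 1 : ℕ) : ℝ) * (σ * m) ^ 2 * (aw * m) = aw / σ * (((N + 1 : ℕ) : ℝ) * (σ * m) ^ 3) := by
    field_simp
  rw [hre, h3]
  field_simp

/-! ## Markov and stationarity for the squared window sum -/

section SquaredWindowSum

variable {σ : ℝ} {N : ℕ} (Φ : HardSphereFlow (Torus.geometry (Fin 3)) (hsDiameter σ N) (N + 1))

/-- **Markov and stationarity for the squared window sum.**  Let `μ` be a law that does not charge the bad set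
(`hμ`) and is preserved by every window shift `Φ_{kw}` (`hstat`), and let the window counts be measurable (`hDm`).
Then for `Kb > 0` the squared window sum `F = ε/(N+1) · Σ_i Σ_{k<Kw} D_{i,k}²` satisfies
`μ{Kb < F} ≤ Kb⁻¹ · ε/(N+1) · Kw · Σ_i ∫ D_{i,0}² dμ`:
Markov's inequality (`meas_ge_le_lintegral_div`), linearity, and `∫ D_{i,k}² dμ = ∫ D_{i,0}² dμ` by the shift
identity `windowCollisions_ae_eq_comp_flow` (`CollisionWindowStationarity`) and the invariance of `μ`.  So tightness of `F`
uniformly in `N` follows from a uniform bound on `(N+1)⁻¹ Σ_i ∫ D_{i,0}² dμ` (`ε Kw ≤ σ (τ/aw + 1)`). [folklore] -/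
theorem measure_lt_windowSqSum_le (hσ : 0 ≤ σ) (μ : Measure (Config (N + 1) (Fin 3) T3)) (hμ : μ Φ.goodᶜ = 0)
    (τ aw : ℝ) (hstat : ∀ k : ℕ, MeasurePreserving (Φ.flow ((k : ℝ) * windowLen N τ aw)) μ μ)
    (hDm : ∀ (i : Fin (N + 1)) (k : ℕ), Measurable (windowCollisions σ N Φ τ aw i k)) {Kb : ℝ} (hKb : 0 < Kb) :
    μ {z | Kb < hsDiameter σ N / (N + 1 : ℝ) *
        ∑ i : Fin (N + 1), ∑ k ∈ Finset.range (windowNum N τ aw), windowCollisions σ N Φ τ aw i k z ^ 2} ≤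
      (ENNReal.ofReal Kb)⁻¹ * (ENNReal.ofReal (hsDiameter σ N / (N + 1 : ℝ)) * (windowNum N τ aw : ℝ≥0∞) *
        ∑ i : Fin (N + 1), ∫⁻ z, ENNReal.ofReal (windowCollisions σ N Φ τ aw i 0 z ^ 2) ∂μ) := by
  have hε : 0 ≤ hsDiameter σ N / (N + 1 : ℝ) := div_nonneg (by unfold hsDiameter; positivity) (by positivity)
  set Kw : ℕ := windowNum N τ aw with hKw
  -- the squared window sum as an `ℝ≥0∞`-valued measurable function
  set g : Config (N + 1) (Fin 3) T3 → ℝ≥0∞ := fun z => ENNReal.ofReal (hsDiameter σ N / (N + 1 : ℝ) *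
    ∑ i : Fin (N + 1), ∑ k ∈ Finset.range Kw, windowCollisions σ N Φ τ aw i k z ^ 2) with hgdef
  have hsm : Measurable fun z => ∑ i : Fin (N + 1), ∑ k ∈ Finset.range Kw, windowCollisions σ N Φ τ aw i k z ^ 2 :=
    Finset.measurable_sum _ fun i _ => Finset.measurable_sum _ fun k _ => (hDm i k).pow_const 2
  have hgm : Measurable g := (measurable_const.mul hsm).ennreal_ofReal
  -- Markov
  have hsub : {z | Kb < hsDiameter σ N / (N + 1 : ℝ) *
      ∑ i : Fin (N + 1), ∑ k ∈ Finset.range Kw, windowCollisions σ N Φ τ aw i k z ^ 2} ⊆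
      {z | ENNReal.ofReal Kb ≤ g z} := fun z hz => ENNReal.ofReal_le_ofReal (le_of_lt hz)
  have hKb0 : ENNReal.ofReal Kb ≠ 0 := (ENNReal.ofReal_pos.2 hKb).ne'
  have hmarkov : μ {z | ENNReal.ofReal Kb ≤ g z} ≤ (ENNReal.ofReal Kb)⁻¹ * ∫⁻ z, g z ∂μ := by
    rw [← ENNReal.div_eq_inv_mul]
    exact meas_ge_le_lintegral_div hgm.aemeasurable hKb0 ENNReal.ofReal_ne_top
  -- linearity
  have hlin : ∫⁻ z, g z ∂μ = ENNReal.ofReal (hsDiameter σ N / (N + 1 : ℝ)) *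
      ∑ i : Fin (N + 1), ∑ k ∈ Finset.range Kw, ∫⁻ z, ENNReal.ofReal (windowCollisions σ N Φ τ aw i k z ^ 2) ∂μ := by
    have hpt : ∀ z, g z = ENNReal.ofReal (hsDiameter σ N / (N + 1 : ℝ)) *
        ∑ i : Fin (N + 1), ∑ k ∈ Finset.range Kw, ENNReal.ofReal (windowCollisions σ N Φ τ aw i k z ^ 2) := by
      intro z
      rw [hgdef]
      dsimp only
      rw [ENNReal.ofReal_mul hε, ENNReal.ofReal_sum_of_nonneg fun i _ =>
        Finset.sum_nonneg fun k _ => sq_nonneg _]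
      congr 1
      exact Finset.sum_congr rfl fun i _ => ENNReal.ofReal_sum_of_nonneg fun k _ => sq_nonneg _
    have hm : ∀ i k, Measurable fun z => ENNReal.ofReal (windowCollisions σ N Φ τ aw i k z ^ 2) :=
      fun i k => ((hDm i k).pow_const 2).ennreal_ofReal
    simp_rw [hpt]
    rw [lintegral_const_mul _ (Finset.measurable_sum _ fun i _ => Finset.measurable_sum _ fun k _ => hm i k),
      lintegral_finsetSum _ fun i _ => Finset.measurable_sum _ fun k _ => hm i k]
    congr 1
    exact Finset.sum_congr rfl fun i _ => lintegral_finsetSum _ fun k _ => hm i k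
  -- stationarity: every window has the second moment of window `0`
  have hstatk : ∀ (i : Fin (N + 1)) (k : ℕ), ∫⁻ z, ENNReal.ofReal (windowCollisions σ N Φ τ aw i k z ^ 2) ∂μ =
      ∫⁻ z, ENNReal.ofReal (windowCollisions σ N Φ τ aw i 0 z ^ 2) ∂μ := by
    intro i k
    have hm0 : Measurable fun z => ENNReal.ofReal (windowCollisions σ N Φ τ aw i 0 z ^ 2) :=
      ((hDm i 0).pow_const 2).ennreal_ofReal
    calc ∫⁻ z, ENNReal.ofReal (windowCollisions σ N Φ τ aw i k z ^ 2) ∂μ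
        = ∫⁻ z, ENNReal.ofReal (windowCollisions σ N Φ τ aw i 0 (Φ.flow ((k : ℝ) * windowLen N τ aw) z) ^ 2) ∂μ := by
          refine lintegral_congr_ae ?_
          filter_upwards [windowCollisions_ae_eq_comp_flow Φ μ hμ τ aw i k] with z hz
          rw [hz]
      _ = ∫⁻ z, ENNReal.ofReal (windowCollisions σ N Φ τ aw i 0 z ^ 2) ∂μ := (hstat k).lintegral_comp hm0
  have hsumk : ∀ i : Fin (N + 1), ∑ k ∈ Finset.range Kw, ∫⁻ z, ENNReal.ofReal (windowCollisions σ N Φ τ aw i k z ^ 2) ∂μ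
      = (Kw : ℝ≥0∞) * ∫⁻ z, ENNReal.ofReal (windowCollisions σ N Φ τ aw i 0 z ^ 2) ∂μ := by
    intro i
    rw [Finset.sum_congr rfl fun k _ => hstatk i k, Finset.sum_const, Finset.card_range, nsmul_eq_mul]
  -- assemble
  calc μ {z | Kb < hsDiameter σ N / (N + 1 : ℝ) *
        ∑ i : Fin (N + 1), ∑ k ∈ Finset.range Kw, windowCollisions σ N Φ τ aw i k z ^ 2}
      ≤ μ {z | ENNReal.ofReal Kb ≤ g z} := measure_mono hsub
    _ ≤ (ENNReal.ofReal Kb)⁻¹ * ∫⁻ z, g z ∂μ := hmarkov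
    _ = (ENNReal.ofReal Kb)⁻¹ * (ENNReal.ofReal (hsDiameter σ N / (N + 1 : ℝ)) * (Kw : ℝ≥0∞) *
          ∑ i : Fin (N + 1), ∫⁻ z, ENNReal.ofReal (windowCollisions σ N Φ τ aw i 0 z ^ 2) ∂μ) := by
        rw [hlin, Finset.sum_congr rfl fun i _ => hsumk i, ← Finset.mul_sum, mul_assoc]

/-- The normalisation of the squared window sum is `N`-free: `ε_N · Kw ≤ σ (τ/aw + 1)` for `σ ≥ 0`, `τ, aw > 0`
(`Kw = ⌈τ (N+1)^{1/3}/aw⌉ ≤ τ (N+1)^{1/3}/aw + 1`, `ε_N = σ (N+1)^{-1/3} ≤ σ`). [folklore] -/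
theorem hsDiameter_mul_windowNum_le {σ : ℝ} (hσ : 0 ≤ σ) (N : ℕ) {τ aw : ℝ} (hτ : 0 < τ) (haw : 0 < aw) :
    hsDiameter σ N * (windowNum N τ aw : ℝ) ≤ σ * (τ / aw + 1) := by
  unfold hsDiameter windowNum
  set m : ℝ := ((N + 1 : ℕ) : ℝ) ^ (-(1 / 3 : ℝ)) with hm
  have hm0 : 0 < m := Real.rpow_pos_of_pos (by positivity) _
  have hm1 : m ≤ 1 := Real.rpow_le_one_of_one_le_of_nonpos (by exact_mod_cast Nat.succ_pos N) (by norm_num)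
  have hceil : (⌈τ / (aw * m)⌉₊ : ℝ) ≤ τ / (aw * m) + 1 :=
    (Nat.ceil_lt_add_one (div_nonneg hτ.le (mul_pos haw hm0).le)).le
  calc σ * m * (⌈τ / (aw * m)⌉₊ : ℝ) ≤ σ * m * (τ / (aw * m) + 1) :=
        mul_le_mul_of_nonneg_left hceil (mul_nonneg hσ hm0.le)
    _ = σ * (τ / aw + m) := by field_simp
    _ ≤ σ * (τ / aw + 1) := mul_le_mul_of_nonneg_left (by linarith) hσ

end SquaredWindowSum

end Literature.MathematicalPhysics.KineticTheory

end
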